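import Literature.NumberTheory.EllipticCurves.KramerTunnell1982.GoodReductionNormProofs
import Literature.NumberTheory.EllipticCurves.KramerTunnell1982.UnramifiedNormIndex
import Mathlib.FieldTheory.Fixed
import Mathlib.Algebra.Polynomial.Identities
import HarnessLib

/-!
# Kramer–Tunnell 1982, Lemma 6.1 (type `I₀`) over an abstract local field: the residue data of
an unramified quadratic automorphism and `Ĥ⁰ = H¹ = 0` for good reduction

K. Kramer, J. Tunnell, *Elliptic curves and local ε-factors*, Compositio Math. **46** (1982),
§6, Lemma 6.1 and its proof (p. 327), the case of good reduction (type `I₀`): for `K/F` the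
unramified quadratic extension of a local field and `E/F` with good reduction,
`N : E(K) → E(F)` is onto ("It follows from Lang's theorem [9] …") and `H¹(G, E(K)) = 0`.

`GoodReductionNormProofs` proves this for an abstract local field `K` with an involutive isometry
`σ`, *given* the residue data `(k ⊆ 𝓀, τ, r, Ẽ, Hensel)` and a unit `θ + σθ`.  This file
**produces that data** from the minimal hypotheses — `σ ≠ 1` an isometric `E`-linear involution of
`K` (`E ⊆ K` any subfield fixed by `σ`) and an `E`-side uniformiser `π` (`σπ = π`,
`|y| < 1 ⇒ |y| ≤ |π|`, i.e. `K/K^σ` unramified) — and assembles the two vanishing statements: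

* `exists_val_map_sub_eq_one` — **`σ̄ ≠ 1`**: some `x ∈ 𝒪_K` has `σx - x ∈ 𝒪_Kˣ` (the inertia
  group of an unramified extension is trivial; proved here by the derivation argument
  `σx - x = (σy)ᵖ - yᵖ + π(σz - z)` for `x = yᵖ + πz`, Serre *Local Fields* IV §1);
* `exists_val_add_map_eq_one` — a `θ ∈ 𝒪_K` with `θ + σθ` a unit;
* `exists_residue_ringEquiv`, `residue_ringEquiv_ne_one` — the residue involution `σ̄` of `𝓀_K`
  (Serre I §7 Prop. 20) and its non-triviality; Artin's theorem for `⟨σ̄⟩` (Mathlib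
  `FixedPoints.finrank_eq_card`) gives the residue extension `𝓀_K / 𝓀_K^{σ̄}` of degree `2`;
* `relIndex_normSubgroup_fixedSubgroup_eq_one_of_unramified` — **`Ĥ⁰(⟨σ⟩, E(K)) = 0`**: for
  `V = X ⊗_E K` integral with `|Δ| = 1`, `[E(K)^σ : N E(K)] = 1`
  (`normSubgroup`/`fixedSubgroup` of `KramerTunnell1982/UnramifiedNormIndex`);
* `ker_norm_le_range_of_unramified` — **`H¹(⟨σ⟩, E(K)) = 0`**: `ker (1 + σ) ≤ im (σ - 1)` on
  `E(K)`.

Theorems only: no definition, no named fact, no `sorry` (D-0026: net debt `0`).  The fixed field,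
the residue automorphism and the reduction data are produced existentially inside the proofs.
One universe `u` (as in `GoodReductionNormProofs`).

## References

* [KramerTunnell1982] K. Kramer, J. Tunnell, Compositio Math. 46 (1982), §6 Lemma 6.1 (p. 327).
* [SerreLocalFields1979] J.-P. Serre, *Local Fields*, GTM 67, Ch. I §7 Prop. 20 (the residue
  automorphism), Ch. IV §1 Prop. 1 and Cor. (inertia; unramified ⇔ `G₀ = 1`).
* [SilvermanAEC2009] J. H. Silverman, *The Arithmetic of Elliptic Curves*, VII.2.1 (Hensel lift
  of non-singular points of the reduction).
-/

noncomputable section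

open scoped Classical NNReal
open ValuativeRel Field
open Literature.NumberTheory.GaloisRepresentations
open Literature.NumberTheory.GaloisRepresentations.IsNonarchimedeanLocalField
open Literature.NumberTheory.EllipticCurves.FormalGroupChart
open _root_.WeierstrassCurve

universe u

namespace Literature.NumberTheory.EllipticCurves.KramerTunnell1982

/-! ## §0 Private local-field plumbing -/

section Plumbing

variable {K : Type u} [Field K] [ValuativeRel K] [TopologicalSpace K] [IsNonarchimedeanLocalField K]
  {w : Valuation K ℝ≥0}
  (hw : ∀ a : K, (w a : ℝ) = algNorm K (algebraMap K (AlgebraicClosure K) a))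

/-- Hensel's lemma in `𝒪[K]` (Mathlib: complete local field). [folklore] -/
private theorem henselianLocalRing_integer'' : HenselianLocalRing 𝒪[K] := by
  letI := IsTopologicalAddGroup.rightUniformSpace K
  haveI := isUniformAddGroup_of_addCommGroup (G := K)
  exact
    { is_henselian := fun f hf a₀ h₁ h₂ =>
        HenselianRing.is_henselian (I := 𝓂[K]) f hf a₀ h₁ (h₂.map _) }

/-- `𝓂[K]` is the set of elements of valuation `< 1`. [folklore] -/
private theorem mem_maximalIdeal_iff'' {a : 𝒪[K]} : a ∈ 𝓂[K] ↔ valuation K (a : K) < 1 := by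
  rw [IsLocalRing.mem_maximalIdeal, mem_nonunits_iff,
    Valuation.Integer.not_isUnit_iff_valuation_lt_one]

include hw

/-- `w a ≤ 1 ↔ a ∈ 𝒪[K]`. [folklore] -/
private theorem w_le_one_iff (a : K) : w a ≤ 1 ↔ a ∈ 𝒪[K] := by
  rw [← NNReal.coe_le_coe, hw, NNReal.coe_one]
  exact algNorm_algebraMap_le_one_iff

/-- `w a < 1 ↔ v(a) < 1`. [folklore] -/
private theorem w_lt_one_iff (a : K) : w a < 1 ↔ valuation K a < 1 := by
  rw [← NNReal.coe_lt_coe, hw, NNReal.coe_one]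
  exact algNorm_algebraMap_lt_one_iff

/-- For `a ∈ 𝒪[K]`: `w a < 1 ↔ a ∈ 𝓂[K]`. [folklore] -/
private theorem w_coe_lt_one_iff (a : 𝒪[K]) : w (a : K) < 1 ↔ a ∈ 𝓂[K] := by
  rw [w_lt_one_iff hw, mem_maximalIdeal_iff'']

/-- For `a ∈ 𝒪[K]`: `ā = 0 ↔ w a < 1`. [folklore] -/
private theorem residue_eq_zero_iff_w (a : 𝒪[K]) :
    IsLocalRing.residue 𝒪[K] a = 0 ↔ w (a : K) < 1 := by
  rw [IsLocalRing.residue_eq_zero_iff, w_coe_lt_one_iff hw]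

/-- For `a, b ∈ 𝒪[K]`: `ā = b̄ ↔ w (a - b) < 1`. [folklore] -/
private theorem residue_eq_residue_iff_w (a b : 𝒪[K]) :
    IsLocalRing.residue 𝒪[K] a = IsLocalRing.residue 𝒪[K] b ↔ w ((a : K) - b) < 1 := by
  rw [← sub_eq_zero, ← map_sub, residue_eq_zero_iff_w hw]
  rfl

/-- `w p < 1` for the residue characteristic `p`. [folklore] -/
private theorem w_ringChar_lt_one : w (ringChar 𝓀[K] : K) < 1 := by
  have h : IsLocalRing.residue 𝒪[K] (ringChar 𝓀[K] : 𝒪[K]) = 0 := by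
    rw [map_natCast]; exact ringChar.Nat.cast_ringChar
  have := (residue_eq_zero_iff_w hw _).mp h
  simpa using this

/-- **Frobenius is onto modulo `𝓂`**: every `x ∈ 𝒪[K]` is a `p`-th power modulo `𝓂[K]`
(`p` the residue characteristic; the residue field is finite, hence perfect). [folklore] -/
private theorem exists_sub_pow_ringChar_lt_one (x : 𝒪[K]) :
    ∃ y : 𝒪[K], w ((x : K) - (y : K) ^ ringChar 𝓀[K]) < 1 := by
  letI : Fintype 𝓀[K] := Fintype.ofFinite _
  obtain ⟨n, hp, hcard⟩ := FiniteField.card 𝓀[K] (ringChar 𝓀[K])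
  refine ⟨x ^ (ringChar 𝓀[K]) ^ ((n : ℕ) - 1), ?_⟩
  have h := (residue_eq_residue_iff_w hw x ((x ^ (ringChar 𝓀[K]) ^ ((n : ℕ) - 1)) ^ ringChar 𝓀[K])).mp
    (by
      rw [map_pow, map_pow, ← pow_mul, ← pow_succ, Nat.sub_add_cancel (PNat.pos n), ← hcard,
        FiniteField.pow_card])
  simpa using h

end Plumbing

/-! ## §1 The automorphism is non-trivial on the residue field; the unit `θ + σθ` -/

section Residual

variable {E : Type u} [Field E] {K : Type u} [Field K] [Algebra E K]
  [ValuativeRel K] [TopologicalSpace K] [IsNonarchimedeanLocalField K]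
  {w : Valuation K ℝ≥0}
  (hw : ∀ a : K, (w a : ℝ) = algNorm K (algebraMap K (AlgebraicClosure K) a))
  {σ : K ≃ₐ[E] K} (hσw : ∀ y, w (σ y) = w y)
  {π : K} (hπσ : σ π = π) (hπ0 : 0 < w π) (hπ1 : w π < 1)
  (hdisc : ∀ y : K, w y < 1 → w y ≤ w π)

include hw hσw hπσ hπ0 hπ1 hdisc in
/-- **A non-trivial automorphism of an unramified extension is non-trivial on the residue field**
(the inertia group of an unramified extension is trivial): for an isometric automorphism `σ ≠ 1`
of the local field `K` fixing a uniformiser `π` (`σπ = π`, `|y| < 1 ⇒ |y| ≤ |π|`, i.e. `K/K^σ`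
unramified), some `x ∈ 𝒪_K` has `σx - x` a unit.  Proof (derivations of a perfect field vanish):
if `σ ≡ 1 (mod 𝓂)` on `𝒪_K` then, writing `x = yᵖ + πz` (the residue field is perfect),
`σx - x = (σy)ᵖ - yᵖ + π(σz - z) ∈ (p·(σy - y), (σy - y)², π(σz - z))`, so by induction
`σ ≡ 1 (mod 𝓂ⁿ)` for all `n`, i.e. `σ = 1`.  Serre, *Local Fields*, Ch. I §7 Prop. 20–21 and
Ch. IV §1 (for `K'/F` unramified the inertia group `G₀ = {s : s ≡ 1 on 𝓀'}` is trivial).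
[cite: SerreLocalFields1979, Ch. IV §1 Prop. 1 and Cor. (G₀ trivial iff unramified)] -/
theorem exists_val_map_sub_eq_one (hσ1 : σ ≠ 1) : ∃ x : K, w x ≤ 1 ∧ w (σ x - x) = 1 := by
  by_contra hcon
  push Not at hcon
  have hle1 : ∀ x : K, w x ≤ 1 → w (σ x - x) ≤ 1 := fun x hx =>
    (w.map_sub _ _).trans (max_le (by rwa [hσw]) hx)
  have hlt : ∀ x : K, w x ≤ 1 → w (σ x - x) ≤ w π := fun x hx =>
    hdisc _ (lt_of_le_of_ne (hle1 x hx) (hcon x hx))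
  have hp1 : w (ringChar 𝓀[K] : K) ≤ w π := hdisc _ (w_ringChar_lt_one hw)
  have hπle : w π ≤ 1 := hπ1.le
  have hπne : π ≠ 0 := fun h => by rw [h, map_zero] at hπ0; exact lt_irrefl _ hπ0
  -- `σ ≡ 1 (mod 𝓂^{n+1})` on `𝒪_K`, by induction on `n`
  have key : ∀ n : ℕ, ∀ x : K, w x ≤ 1 → w (σ x - x) ≤ w π ^ (n + 1) := by
    intro n
    induction n with
    | zero => intro x hx; rw [zero_add, pow_one]; exact hlt x hx
    | succ n ih =>
      intro x hx
      obtain ⟨y, hy⟩ := exists_sub_pow_ringChar_lt_one hw ⟨x, (w_le_one_iff hw x).mp hx⟩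
      have hyO : w (y : K) ≤ 1 := (w_le_one_iff hw _).mpr y.2
      obtain ⟨z, hz, hxyz⟩ : ∃ z : K, w z ≤ 1 ∧ x = (y : K) ^ ringChar 𝓀[K] + π * z := by
        refine ⟨(x - (y : K) ^ ringChar 𝓀[K]) / π, ?_, ?_⟩
        · rw [map_div₀, div_le_one₀ hπ0]
          exact hdisc _ hy
        · field_simp
          ring
      have hδ : w (σ y - y) ≤ w π ^ (n + 1) := ih _ hyO
      have hδ1 : w (σ y - y) ≤ 1 := hδ.trans (pow_le_one₀ zero_le hπle)
      obtain ⟨kk, hkk⟩ := Polynomial.powAddExpansion y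
        (⟨σ y - y, (w_le_one_iff hw _).mp hδ1⟩ : 𝒪[K]) (ringChar 𝓀[K])
      have hkkK := congrArg ((↑) : 𝒪[K] → K) hkk
      push_cast at hkkK
      rw [add_sub_cancel] at hkkK
      have hσx : σ x - x = ((σ y) ^ ringChar 𝓀[K] - (y : K) ^ ringChar 𝓀[K]) + π * (σ z - z) := by
        rw [hxyz, map_add, map_pow, map_mul, hπσ]; ring
      have hpow2 : w π ^ (n + 1 + 1) = w π * w π ^ (n + 1) := pow_succ' _ _
      have hA : w ((σ y) ^ ringChar 𝓀[K] - (y : K) ^ ringChar 𝓀[K]) ≤ w π ^ (n + 1 + 1) := by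
        have hrw : (σ y) ^ ringChar 𝓀[K] - (y : K) ^ ringChar 𝓀[K] =
            (ringChar 𝓀[K] : K) * (y : K) ^ (ringChar 𝓀[K] - 1) * (σ y - y) +
              (kk : K) * (σ y - y) ^ 2 := by
          rw [hkkK]; ring
        rw [hrw, hpow2]
        refine (w.map_add _ _).trans (max_le ?_ ?_)
        · rw [map_mul, map_mul, map_pow]
          calc w (ringChar 𝓀[K] : K) * w (y : K) ^ (ringChar 𝓀[K] - 1) * w (σ y - y)
              ≤ w π * 1 * w π ^ (n + 1) :=
                mul_le_mul' (mul_le_mul' hp1 (pow_le_one₀ zero_le hyO)) hδ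
            _ = w π * w π ^ (n + 1) := by rw [mul_one]
        · rw [map_mul, map_pow]
          calc w (kk : K) * w (σ y - y) ^ 2 ≤ 1 * (w π ^ (n + 1)) ^ 2 :=
                mul_le_mul' ((w_le_one_iff hw _).mpr kk.2) (pow_le_pow_left' hδ 2)
            _ = w π ^ (n + 1) * w π ^ (n + 1) := by rw [one_mul, sq]
            _ ≤ w π * w π ^ (n + 1) :=
                mul_le_mul' (pow_le_of_le_one zero_le hπle (Nat.succ_ne_zero n)) le_rfl
      have hB : w (π * (σ z - z)) ≤ w π ^ (n + 1 + 1) := by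
        rw [map_mul, hpow2]; exact mul_le_mul' le_rfl (ih z hz)
      rw [hσx]
      exact (w.map_add _ _).trans (max_le hA hB)
  -- hence `σ = 1` on `𝒪_K`, and on `K`
  have hfixO : ∀ x : K, w x ≤ 1 → σ x = x := by
    intro x hx
    by_contra hne
    have hpos : 0 < w (σ x - x) := by
      rw [pos_iff_ne_zero, ne_eq, map_eq_zero]; exact sub_ne_zero.mpr hne
    obtain ⟨n, hn⟩ := exists_pow_lt_of_lt_one hpos hπ1
    have h := (key n x hx).trans (pow_le_pow_right_of_le_one' hπle (Nat.le_succ n))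
    exact absurd h (not_le.mpr hn)
  apply hσ1
  refine AlgEquiv.ext fun x => ?_
  rw [AlgEquiv.one_apply]
  by_cases hx : w x ≤ 1
  · exact hfixO x hx
  · have hinv : w x⁻¹ ≤ 1 := by
      rw [map_inv₀]; exact inv_le_one_of_one_le₀ (le_of_not_ge hx)
    have h := hfixO _ hinv
    rwa [map_inv₀, inv_inj] at h

include hw hσw hπσ hπ0 hπ1 hdisc in
/-- **The unit `θ + σθ`** (a lift of an element of non-zero trace of the residue extension): for
`σ ≠ 1` as above there is `θ ∈ 𝒪_K` with `θ + σθ ∈ 𝒪_Kˣ` — `θ = 1` in odd residue characteristic,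
and `θ = x` with `σx - x` a unit (`exists_val_map_sub_eq_one`) when `|2| < 1`, since then
`x + σx = (σx - x) + 2x`.  Serre, *Local Fields*, Ch. IV §1 (unramified ⇒ `G₀ = 1`), with
Ch. V §2 (the trace of an unramified extension is onto). [cite: SerreLocalFields1979, Ch. IV §1 Prop. 1 and Cor.] -/
theorem exists_val_add_map_eq_one (hσ1 : σ ≠ 1) : ∃ θ : K, w θ ≤ 1 ∧ w (θ + σ θ) = 1 := by
  by_cases h2 : w (2 : K) = 1
  · exact ⟨1, by rw [map_one], by rw [map_one, one_add_one_eq_two, h2]⟩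
  · obtain ⟨x, hx, hσx⟩ := exists_val_map_sub_eq_one hw hσw hπσ hπ0 hπ1 hdisc hσ1
    have h2le : w (2 : K) ≤ 1 := by
      have h := w.map_add 1 1
      rwa [map_one, max_self, one_add_one_eq_two] at h
    have h2lt : w (2 : K) < 1 := lt_of_le_of_ne h2le h2
    refine ⟨x, hx, ?_⟩
    have hrw : x + σ x = (σ x - x) + 2 * x := by ring
    rw [hrw, Valuation.map_add_eq_of_lt_left, hσx]
    rw [hσx, map_mul]
    calc w 2 * w x ≤ w 2 * 1 := mul_le_mul' le_rfl hx
      _ < 1 := by rw [mul_one]; exact h2lt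

end Residual

/-! ## §2 The residue automorphism and its fixed field -/

section ResidueAut

variable {E : Type u} [Field E] {K : Type u} [Field K] [Algebra E K]
  [ValuativeRel K] [TopologicalSpace K] [IsNonarchimedeanLocalField K]
  {w : Valuation K ℝ≥0}
  (hw : ∀ a : K, (w a : ℝ) = algNorm K (algebraMap K (AlgebraicClosure K) a))
  {σ : K ≃ₐ[E] K} (hσw : ∀ y, w (σ y) = w y)

include hw hσw in
/-- **The residue automorphism** `σ̄` of `𝓀_K` induced by an isometric involution `σ` of `K`
(`σ𝒪_K = 𝒪_K`, `σ𝓂_K = 𝓂_K`): an involution `σ̄` of `𝓀_K` with `σ̄(ā) = \overline{σa}`.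
Serre, *Local Fields*, Ch. I §7 (Prop. 20: `s ↦ s̄`, `G → Aut(𝓀')`). Produced existentially
(Mathlib `IsLocalRing.ResidueField.mapEquiv`); no definition.
[cite: SerreLocalFields1979, Ch. I §7 Prop. 20] -/
theorem exists_residue_ringEquiv (hσσ : ∀ y, σ (σ y) = y) :
    ∃ τ : 𝓀[K] ≃+* 𝓀[K], (∀ v, τ (τ v) = v) ∧
      ∀ a b : 𝒪[K], (b : K) = σ a →
        τ (IsLocalRing.residue 𝒪[K] a) = IsLocalRing.residue 𝒪[K] b := by
  have hmem : ∀ a : K, a ∈ 𝒪[K] → σ a ∈ 𝒪[K] := fun a ha =>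
    (w_le_one_iff hw _).mp (by rw [hσw]; exact (w_le_one_iff hw a).mpr ha)
  let σO : 𝒪[K] ≃+* 𝒪[K] :=
    { toFun := fun a => ⟨σ a, hmem a a.2⟩
      invFun := fun a => ⟨σ a, hmem a a.2⟩
      left_inv := fun a => Subtype.ext (hσσ a)
      right_inv := fun a => Subtype.ext (hσσ a)
      map_mul' := fun a b => Subtype.ext (map_mul σ _ _)
      map_add' := fun a b => Subtype.ext (map_add σ _ _) }
  refine ⟨IsLocalRing.ResidueField.mapEquiv σO, fun v => ?_, fun a b hab => ?_⟩
  · obtain ⟨a, rfl⟩ := IsLocalRing.residue_surjective v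
    simp only [IsLocalRing.ResidueField.mapEquiv_apply, IsLocalRing.ResidueField.map_residue]
    exact congrArg _ (Subtype.ext (hσσ a))
  · simp only [IsLocalRing.ResidueField.mapEquiv_apply, IsLocalRing.ResidueField.map_residue]
    exact congrArg _ (Subtype.ext hab.symm)

include hw in
/-- The residue automorphism of `σ` is non-trivial as soon as some `x ∈ 𝒪_K` has `σx - x` a unit
(`exists_val_map_sub_eq_one`): `σ̄ x̄ = \overline{σx} ≠ x̄`.  Serre, *Local Fields*, Ch. IV §1
(`G₀ = 1` for an unramified extension). [cite: SerreLocalFields1979, Ch. IV §1 Prop. 1 and Cor.] -/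
theorem residue_ringEquiv_ne_one {τ : 𝓀[K] ≃+* 𝓀[K]}
    (hτ : ∀ a b : 𝒪[K], (b : K) = σ a →
      τ (IsLocalRing.residue 𝒪[K] a) = IsLocalRing.residue 𝒪[K] b)
    {x : K} (hx : w x ≤ 1) (hσx : w (σ x - x) = 1) : τ ≠ 1 := by
  intro h1
  have hσxO : σ x ∈ 𝒪[K] := (w_le_one_iff hw _).mp (by
    have h := w.map_add (σ x - x) x
    rw [sub_add_cancel, hσx] at h
    exact h.trans (max_le le_rfl hx))
  have h := hτ ⟨x, (w_le_one_iff hw x).mp hx⟩ ⟨σ x, hσxO⟩ rfl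
  rw [h1, RingAut.one_apply, residue_eq_residue_iff_w hw] at h
  rw [Valuation.map_sub_swap] at hσx
  exact absurd hσx (ne_of_lt h)

omit [ValuativeRel K] [TopologicalSpace K] [IsNonarchimedeanLocalField K] in
/-- **Artin's theorem for an involution**: a ring involution `τ ≠ 1` of a field `k'` is the
non-trivial automorphism of `k'` over its fixed field `k = k'^τ`, and `[k' : k] = 2`
(Mathlib `FixedPoints.finrank_eq_card`, `MulSemiringAction.toAlgEquiv` for the group `⟨τ⟩` of
order `2`).  The fixed field is produced existentially; no definition. [folklore] -/
private theorem exists_fixedField_of_involutive {k' : Type u} [Field k'] (τ : k' ≃+* k')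
    (hτ1 : τ ≠ 1) (hττ : ∀ v, τ (τ v) = v) :
    ∃ (k : Type u) (_ : Field k) (_ : Algebra k k') (ρ : k' ≃ₐ[k] k'),
      Module.finrank k k' = 2 ∧ ρ ≠ 1 ∧ (∀ v, ρ v = τ v) ∧
        ∀ v, τ v = v → v ∈ Set.range (algebraMap k k') := by
  set G : Subgroup (k' ≃+* k') := Subgroup.zpowers τ with hG
  have hsq : τ ^ 2 = 1 := by
    ext v; rw [sq, RingAut.mul_apply, RingAut.one_apply]; exact hττ v
  have hord : orderOf τ = 2 := orderOf_eq_prime hsq hτ1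
  haveI : Finite G := Nat.finite_of_card_ne_zero (by rw [hG, Nat.card_zpowers, hord]; decide)
  letI : Fintype G := Fintype.ofFinite G
  refine ⟨FixedPoints.subfield G k', inferInstance, inferInstance,
    MulSemiringAction.toAlgEquiv _ k' (⟨τ, hG ▸ Subgroup.mem_zpowers τ⟩ : G), ?_, ?_, ?_, ?_⟩
  · rw [FixedPoints.finrank_eq_card G k', ← Nat.card_eq_fintype_card, hG, Nat.card_zpowers, hord]
  · intro h
    apply hτ1
    ext v
    have hv := AlgEquiv.congr_fun h v
    rw [MulSemiringAction.toAlgEquiv_apply, AlgEquiv.one_apply] at hv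
    exact hv
  · intro v
    rw [MulSemiringAction.toAlgEquiv_apply]
    rfl
  · intro v hv
    refine ⟨⟨v, fun g => ?_⟩, rfl⟩
    obtain ⟨g, hg⟩ := g
    obtain ⟨j, rfl⟩ := Subgroup.mem_zpowers_iff.mp (hG ▸ hg)
    exact MulAction.fixedBy_subset_fixedBy_zpow k' τ j hv

end ResidueAut

/-! ## §3 Residue data of an unramified quadratic automorphism and the assembly -/

section Main

variable {E : Type u} [Field E] {K : Type u} [Field K] [Algebra E K]
  [ValuativeRel K] [TopologicalSpace K] [IsNonarchimedeanLocalField K]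
  (X : WeierstrassCurve E) {w : Valuation K ℝ≥0}
  (hw : ∀ a : K, (w a : ℝ) = algNorm K (algebraMap K (AlgebraicClosure K) a))
  [hVE : (X.baseChange K).IsElliptic] [hV : (X.baseChange K).IsIntegral w.integer]
  (hΔ : w (X.baseChange K).Δ = 1)
  {σ : K ≃ₐ[E] K} (hσw : ∀ y, w (σ y) = w y) (hσσ : ∀ y, σ (σ y) = y) (hσ1 : σ ≠ 1)
  {π : K} (hπσ : σ π = π) (hπ0 : 0 < w π) (hπ1 : w π < 1)
  (hdisc : ∀ y : K, w y < 1 → w y ≤ w π)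

omit hVE in
include hw hΔ hσw hσσ hσ1 hπσ hπ0 hπ1 hdisc in
/-- **Residue data** of `(K, σ)` for `V = X ⊗ K` integral with `|Δ| = 1` (the hypotheses of
`exists_add_map_eq_of_good`): the residue field `𝓀_K ⊇ k = 𝓀_K^{σ̄}` with `[𝓀_K : k] = 2`
(`σ̄ ≠ 1`, `exists_val_map_sub_eq_one`), the reduction map `r : 𝒪_w → 𝓀_K` (`r(σa) = σ̄ r(a)`),
the reduced curve `Ẽ` over `k` (the coefficients of `V` come from `E = K^σ`, so their residues are
`σ̄`-fixed) with `Ẽ ⊗ 𝓀_K = Ṽ` elliptic, and Hensel lifting of its non-singular points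
(`exists_equation_residue_eq`, `𝒪_K` henselian).  Serre, *Local Fields*, Ch. I §7 Prop. 20 and
Ch. IV §1; Silverman, *AEC*, VII.2.1. [cite: SerreLocalFields1979, Ch. I §7 Prop. 20] -/
private theorem exists_residue_data :
    ∃ (k : Type u) (_ : Field k) (_ : Finite k) (_ : Algebra k 𝓀[K]) (τ : 𝓀[K] ≃ₐ[k] 𝓀[K])
      (r : w.integer →+* 𝓀[K]) (Ek : WeierstrassCurve k) (_ : Ek.IsElliptic),
      Module.finrank k 𝓀[K] = 2 ∧ τ ≠ 1 ∧ (∀ a : w.integer, r a = 0 ↔ w (a : K) < 1) ∧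
      (∀ a a' : w.integer, (a' : K) = σ a → r a' = τ (r a)) ∧
      reduceCurve r (X.baseChange K) = Ek.baseChange 𝓀[K] ∧
      ∀ α β : 𝓀[K], (Ek.baseChange 𝓀[K]).toAffine.Nonsingular α β →
        ∃ (x y : K) (_ : (X.baseChange K).toAffine.Nonsingular x y),
          w x ≤ 1 ∧ reduceFun r x = α ∧ reduceFun r y = β := by
  -- the residue automorphism and its fixed field
  obtain ⟨x, hx, hσx⟩ := exists_val_map_sub_eq_one hw hσw hπσ hπ0 hπ1 hdisc hσ1
  obtain ⟨τ', hτ'τ', hτ'σ⟩ := exists_residue_ringEquiv hw hσw hσσ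
  have hτ'1 : τ' ≠ 1 := residue_ringEquiv_ne_one hw hτ'σ hx hσx
  obtain ⟨k, _, _, τ, h2, hτ1, hττ', hrange⟩ := exists_fixedField_of_involutive τ' hτ'1 hτ'τ'
  haveI : Finite k := Finite.of_injective _ (algebraMap k 𝓀[K]).injective
  -- the reduction map on `𝒪_w ⊆ 𝒪_K`
  have hle : w.integer ≤ 𝒪[K] := fun a ha => (w_le_one_iff hw a).mp ha
  let ι : w.integer →+* 𝒪[K] := Subring.inclusion hle
  let r : w.integer →+* 𝓀[K] := (IsLocalRing.residue 𝒪[K]).comp ι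
  have hr : ∀ a : w.integer, r a = 0 ↔ w (a : K) < 1 := fun a => residue_eq_zero_iff_w hw (ι a)
  have hrσ : ∀ a a' : w.integer, (a' : K) = σ a → r a' = τ (r a) := fun a a' h => by
    rw [hττ']; exact (hτ'σ (ι a) (ι a') h).symm
  -- the integral model and its reduction over `k`
  obtain ⟨M, hM⟩ := hV.integral
  have hfix : ∀ (a : w.integer) (e : E), (a : K) = algebraMap E K e → τ' (r a) = r a :=
    fun a e hae => hτ'σ (ι a) (ι a) (by change (a : K) = σ (a : K); rw [hae, AlgEquiv.commutes])
  have ha₁ : (M.a₁ : K) = algebraMap E K X.a₁ := by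
    have h := congrArg WeierstrassCurve.a₁ hM; rw [baseChange_a₁, baseChange_a₁] at h; exact h.symm
  have ha₂ : (M.a₂ : K) = algebraMap E K X.a₂ := by
    have h := congrArg WeierstrassCurve.a₂ hM; rw [baseChange_a₂, baseChange_a₂] at h; exact h.symm
  have ha₃ : (M.a₃ : K) = algebraMap E K X.a₃ := by
    have h := congrArg WeierstrassCurve.a₃ hM; rw [baseChange_a₃, baseChange_a₃] at h; exact h.symm
  have ha₄ : (M.a₄ : K) = algebraMap E K X.a₄ := by
    have h := congrArg WeierstrassCurve.a₄ hM; rw [baseChange_a₄, baseChange_a₄] at h; exact h.symm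
  have ha₆ : (M.a₆ : K) = algebraMap E K X.a₆ := by
    have h := congrArg WeierstrassCurve.a₆ hM; rw [baseChange_a₆, baseChange_a₆] at h; exact h.symm
  obtain ⟨c₁, hc₁⟩ := hrange _ (hfix M.a₁ X.a₁ ha₁)
  obtain ⟨c₂, hc₂⟩ := hrange _ (hfix M.a₂ X.a₂ ha₂)
  obtain ⟨c₃, hc₃⟩ := hrange _ (hfix M.a₃ X.a₃ ha₃)
  obtain ⟨c₄, hc₄⟩ := hrange _ (hfix M.a₄ X.a₄ ha₄)
  obtain ⟨c₆, hc₆⟩ := hrange _ (hfix M.a₆ X.a₆ ha₆)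
  set Ek : WeierstrassCurve k := ⟨c₁, c₂, c₃, c₄, c₆⟩ with hEk
  have hVt : reduceCurve r (X.baseChange K) = Ek.baseChange 𝓀[K] := by
    rw [hM, reduceCurve_baseChange]
    ext <;> simp only [hEk, WeierstrassCurve.baseChange, map_a₁, map_a₂, map_a₃, map_a₄, map_a₆,
      hc₁, hc₂, hc₃, hc₄, hc₆]
  -- `Ẽ` is elliptic: `r(Δ) ≠ 0` since `|Δ| = 1`
  have hMΔ : ((M.Δ : w.integer) : K) = (X.baseChange K).Δ := by rw [hM, coe_model_Δ]
  have hΔr : r M.Δ ≠ 0 := by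
    rw [ne_eq, hr, not_lt, hMΔ, hΔ]
  have hEkΔ : algebraMap k 𝓀[K] Ek.Δ = r M.Δ := by
    have h := congrArg WeierstrassCurve.Δ hVt
    rw [hM, reduceCurve_baseChange, map_Δ, WeierstrassCurve.baseChange, map_Δ] at h
    exact h.symm
  haveI hEkE : Ek.IsElliptic :=
    ⟨Ne.isUnit fun h0 => hΔr (by rw [← hEkΔ, h0, map_zero])⟩
  -- Hensel lifting over `𝒪_K`
  haveI := henselianLocalRing_integer'' (K := K)
  have hhensel : ∀ α β : 𝓀[K], (Ek.baseChange 𝓀[K]).toAffine.Nonsingular α β →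
      ∃ (x y : K) (_ : (X.baseChange K).toAffine.Nonsingular x y),
        w x ≤ 1 ∧ reduceFun r x = α ∧ reduceFun r y = β := by
    intro α β hns
    let MO : WeierstrassCurve 𝒪[K] := M.map ι
    have hMO : MO.map (IsLocalRing.residue 𝒪[K]) = Ek.baseChange 𝓀[K] := by
      rw [← hVt, hM, reduceCurve_baseChange, WeierstrassCurve.map_map]
    rw [← hMO] at hns
    obtain ⟨a, b, hab, ha, hb⟩ := WeierstrassCurve.exists_equation_residue_eq MO hns
    rw [← ha, ← hb] at hns
    have hV' : MO.baseChange K = X.baseChange K := by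
      rw [hM]
      simp only [MO, WeierstrassCurve.baseChange, WeierstrassCurve.map_map]
      rfl
    have hP := WeierstrassCurve.nonsingular_baseChange_of_nonsingular_residue (K := K) MO hab hns
    rw [hV'] at hP
    refine ⟨(a : K), (b : K), hP, (w_le_one_iff hw _).mpr a.2, ?_, ?_⟩
    · rw [reduceFun_of_le r ((w_le_one_iff hw _).mpr a.2), ← ha]; rfl
    · rw [reduceFun_of_le r ((w_le_one_iff hw _).mpr b.2), ← hb]; rfl
  exact ⟨k, inferInstance, inferInstance, inferInstance, τ, r, Ek, hEkE, h2, hτ1, hr, hrσ, hVt,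
    hhensel⟩

include hw hΔ hσw hσσ hσ1 hπσ hπ0 hπ1 hdisc in
/-- **`Ĥ⁰(⟨σ⟩, E(K)) = 0`: the norm index `[E(K)^σ : N E(K)]` is `1` for good reduction and
`K/K^σ` unramified quadratic** — the type-`I₀` case of Kramer–Tunnell's Lemma 6.1 over an abstract
local field: for `V = X ⊗_E K` integral with `|Δ| = 1` and `σ ≠ 1` an isometric `E`-involution of
`K` fixing a uniformiser `π` (`σπ = π`, `|y| < 1 ⇒ |y| ≤ |π|`), every `σ`-fixed point of `E(K)`
is a norm `Q + σQ`, i.e. `(normSubgroup).relIndex (fixedSubgroup) = 1` in the vocabulary of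
`KramerTunnell1982/UnramifiedNormIndex`.  Assembly of `exists_add_map_eq_of_good` with the residue
data of `(K, σ)` (`σ̄ ≠ 1`, `[𝓀_K : 𝓀_K^{σ̄}] = 2`, the reduced curve over `𝓀_K^{σ̄}`, Hensel)
and the unit `θ + σθ` (`exists_val_add_map_eq_one`).  Kramer–Tunnell: "It follows from Lang's
theorem [9] that `N : E₀(K) → E₀(F)` is surjective … type `I₀` … `dim E(F)/NE(K) = 0`".
[cite: KramerTunnell1982, §6 Lemma 6.1 and its proof (p. 327), type I₀] -/
theorem relIndex_normSubgroup_fixedSubgroup_eq_one_of_unramified :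
    (normSubgroup X K σ).relIndex (fixedSubgroup X K σ) = 1 := by
  rw [AddSubgroup.relIndex_eq_one]
  intro P hP
  rw [mem_fixedSubgroup_iff] at hP
  obtain ⟨θ, hθ, hθt⟩ := exists_val_add_map_eq_one hw hσw hπσ hπ0 hπ1 hdisc hσ1
  obtain ⟨k, _, _, _, τ, r, Ek, _, h2, hτ1, hr, hrσ, hVt, hhensel⟩ :=
    exists_residue_data X hw hΔ hσw hσσ hσ1 hπσ hπ0 hπ1 hdisc
  exact mem_normSubgroup_iff.mpr (exists_add_map_eq_of_good X hw hΔ hσw hσσ hπσ hπ0 hπ1 hdisc hθ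
    hθt h2 τ hτ1 r hr hrσ Ek hVt hhensel hP)

include hw hΔ hσw hσσ hσ1 hπσ hπ0 hπ1 hdisc in
/-- **`H¹(⟨σ⟩, E(K)) = 0` for good reduction and `K/K^σ` unramified quadratic** (the companion
statement): the kernel of the norm `P ↦ P + σP` on `E(K)` is contained in (hence equal to) the
image of `Q ↦ σQ - Q`.  Assembly of `exists_map_sub_eq_of_good` with the residue data.
Kramer–Tunnell, proof of Lemma 6.1: "`|H¹(G, E₀(K))| = |E(F) / N E₀(K)| = 1`" (type `I₀`:
`E₀ = E`). [cite: KramerTunnell1982, §6 proof of Lemma 6.1 (p. 327), |H¹(G, E₀(K))| = 1] -/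
theorem ker_norm_le_range_of_unramified :
    (AddMonoidHom.id _ + WeierstrassCurve.Affine.Point.map (W' := X) (σ : K →ₐ[E] K)).ker ≤
      (WeierstrassCurve.Affine.Point.map (W' := X) (σ : K →ₐ[E] K) - AddMonoidHom.id _).range := by
  intro P hP
  rw [AddMonoidHom.mem_ker, AddMonoidHom.add_apply, AddMonoidHom.id_apply] at hP
  obtain ⟨θ, hθ, hθt⟩ := exists_val_add_map_eq_one hw hσw hπσ hπ0 hπ1 hdisc hσ1
  obtain ⟨k, _, _, _, τ, r, Ek, _, h2, hτ1, hr, hrσ, hVt, hhensel⟩ :=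
    exists_residue_data X hw hΔ hσw hσσ hσ1 hπσ hπ0 hπ1 hdisc
  obtain ⟨Q, hQ⟩ := exists_map_sub_eq_of_good X hw hΔ hσw hσσ hπσ hπ0 hπ1 hdisc hθ hθt h2 τ hτ1
    r hr hrσ Ek hVt hhensel hP
  exact ⟨Q, by rw [AddMonoidHom.sub_apply, AddMonoidHom.id_apply]; exact hQ⟩

end Main

end Literature.NumberTheory.EllipticCurves.KramerTunnell1982
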